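import Mathlib
import Summits.ValiantsHypothesis.ValiantsHypothesis.Theorems.MonotoneRestorationOrbitRestorationQPRowColumnEssential
import Summits.ValiantsHypothesis.ValiantsHypothesis.Theorems.MonotoneRestorationOrbitRestorationQPRowColumnRestorable
import HarnessLib

/-!
# The sub-quadratic depth-three stratum of A_∞ is orbit-restorable (ORBIT currency)

Route MonotoneRestoration, crux `OrbitRestorationQP` (stmt-ValiantsHypothesis-18293), line `depth-three-rung`, registered stub
`stub_sigmaPiSigmaValue` (A_∞: matrix-symmetric families with polynomial-size `ΣΠΣ` circuits are quasi-polynomially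
orbit-restorable).  Namespace `Summit.ValiantsHypothesis.ValiantsHypothesis.Theorems.RowColumnStratum`.  Definition-free.

This file closes, end to end and unconditionally, the first stratum of A_∞ in which equivariance is CREATED from an asymmetric
depth-three representation:

* `mem_adjoin_esymm_of_symmetric` — **ONE-BLOCK SYMMETRISATION**: if `p ∈ ℂ[s₀ ∪ {v_j}]` and a family of algebra endomorphisms
  `ρ_τ` (`τ ∈ Sym_n`) fixes `s₀` pointwise, permutes the `v_j` (`ρ_τ v_j = v_{τ j}`) and fixes `p`, then
  `p ∈ ℂ[s₀ ∪ {e_k(v_1, …, v_n)}]` (average a representation over `Sym_n` inside `B[y_1, …, y_n]`, `B = ℂ[s₀]`, and apply the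
  fundamental theorem of symmetric polynomials over the ring `B`, Mathlib `MvPolynomial.esymmAlgHom_surjective`);
* `mem_adjoin_esymm_rowcol` — applied twice (columns over `ℂ[rows]`, then rows over `ℂ[e(columns)]`): a MATRIX-SYMMETRIC
  element of `ℂ[r, c]` (row sums `r_i`, column sums `c_j`) is a polynomial in `e_k(r)`, `e_k(c)` (`1 ≤ k ≤ n`);
* `aeval_esymm_mem_adjoin_powerSums` — Newton's identities, transported: `e_k(v) ∈ ℂ[Σ_i v_i^m : 1 ≤ m ≤ n]`
  (cf. `NewtonProdPsum.esymm_mem_adjoin_psum`, same induction on Mathlib's `MvPolynomial.mul_esymm_eq_sum`);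
* `qpOrbitRestorable_of_mem_adjoin_rowcol` — hence (with `RowColumnRestorable.qpOrbitRestorable_of_mem_adjoin_powerSums`) every
  matrix-symmetric element of `ℂ[r, c]` is `QPOrbitRestorable 9 n`;
* `qpOrbitRestorable_of_depthThree_subquadratic` — **THE SUB-QUADRATIC DEPTH-THREE STRATUM OF A_∞**: a matrix-symmetric
  `p = Σ_{i<k} C(a i) · Π (L i)` (affine factors) with total product fan-in `Σ_i |L i| < (n−1)²` is `QPOrbitRestorable 9 n`
  (`RowColumnDichotomy.mem_adjoin_rowcol_of_depthThree` + the above);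
* `restoration_of_subquadratic_family` — the same in the shape of the stub: for a matrix-symmetric FAMILY given at every level by
  such a representation, `∃ c, ∀ n, QPOrbitRestorable c n (f n)` (with `c = 9`);
* `qpOrbitRestorable_of_admissible`, `qpOrbitRestorable_of_depthThree_distinct` — the stratum by ESSENTIAL DIMENSION (`dim Λ ≤ (n−1)²`
  for any admissible `Λ`) and by number of DISTINCT affine factors (`< (n−1)²`, total fan-in and number of terms irrelevant).

Calibration: a thin but genuine stratum (total fan-in `< (n−1)²`, so it contains the slice `PDClass 1 n 1` of the rung for `n ≥ 4`
only through its representations, not all of `PDClass 1 n c`); unconditional, VH-free; above the threshold the essential-variable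
dichotomy says that every depth-three representation of a matrix-symmetric `p ∉ ℂ[r, c]` has factor span containing all `(n−1)²`
double-difference forms — the regime where the rank-bound / wild-residue analysis of the line lives.  Nothing here bears on VP ≠ VNP.
[folklore]

## References
* A. Dawar, G. Wilsenach, *Symmetric arithmetic circuits*, ToC 21 (2025), §3.3. [DawarWilsenach2025]
-/

noncomputable section

open scoped Classical

-- `Summit.ValiantsHypothesis.ValiantsHypothesis.…` is the tree's single-conjunct layout (Sub = Summit).
set_option linter.dupNamespace false

namespace Summit.ValiantsHypothesis.ValiantsHypothesis.Theorems

namespace RowColumnStratum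

open MvPolynomial Equiv Literature.Computability.AlgebraicComplexity OrbitRestorationQPDepthThreeRung

variable {n : ℕ}

/-! ### One-block symmetrisation over a fixed subalgebra -/

/-- **ONE-BLOCK SYMMETRISATION.**  Let `s₀` be a set of polynomials, `v_0, …, v_{n-1}` further polynomials, and `ρ_τ`
(`τ ∈ Sym_n`) algebra endomorphisms fixing `s₀` pointwise with `ρ_τ v_j = v_{τ j}`.  If `p ∈ ℂ[s₀ ∪ {v_j}]` is fixed by every
`ρ_τ`, then `p ∈ ℂ[s₀ ∪ {e_{k+1}(v) : k < n}]`. [folklore] -/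
theorem mem_adjoin_esymm_of_symmetric (s₀ : Set (MvPolynomial (Fin n × Fin n) ℂ))
    (v : Fin n → MvPolynomial (Fin n × Fin n) ℂ)
    (ρ : Perm (Fin n) → (MvPolynomial (Fin n × Fin n) ℂ →ₐ[ℂ] MvPolynomial (Fin n × Fin n) ℂ))
    (hρs : ∀ τ, ∀ x ∈ s₀, ρ τ x = x) (hρv : ∀ τ j, ρ τ (v j) = v (τ j))
    {p : MvPolynomial (Fin n × Fin n) ℂ} (hρp : ∀ τ, ρ τ p = p)
    (hp : p ∈ Algebra.adjoin ℂ (s₀ ∪ Set.range v)) :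
    p ∈ Algebra.adjoin ℂ (s₀ ∪ Set.range fun k : Fin n => aeval v (esymm (Fin n) ℂ ((k : ℕ) + 1))) := by
  set B : Subalgebra ℂ (MvPolynomial (Fin n × Fin n) ℂ) := Algebra.adjoin ℂ s₀ with hBdef
  -- Step 1: a representation `p = aeval v F` with `F ∈ B[y_0, …, y_{n-1}]`
  have hp' : p ∈ Algebra.adjoin B (Set.range v) := by
    have h := hp
    rw [Algebra.adjoin_union_eq_adjoin_adjoin] at h
    exact (Subalgebra.mem_restrictScalars ℂ).1 h
  rw [Algebra.adjoin_range_eq_range_aeval, AlgHom.mem_range] at hp'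
  obtain ⟨F, hF⟩ := hp'
  -- Step 2: `ρ τ` fixes `B` pointwise, hence `ρ τ (aeval v F) = aeval v (rename τ F)`
  have hρB : ∀ (τ : Perm (Fin n)) (b : B), ρ τ (b : MvPolynomial (Fin n × Fin n) ℂ) = b := by
    intro τ b
    have hle : B ≤ AlgHom.equalizer (ρ τ) (AlgHom.id ℂ (MvPolynomial (Fin n × Fin n) ℂ)) := by
      rw [hBdef]
      exact Algebra.adjoin_le fun x hx => (AlgHom.mem_equalizer _ _ x).2 (by rw [AlgHom.id_apply]; exact hρs τ x hx)
    have := (AlgHom.mem_equalizer _ _ _).1 (hle b.2)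
    rwa [AlgHom.id_apply] at this
  have hρF : ∀ τ : Perm (Fin n), ρ τ (aeval v F) = aeval v (rename τ F) := by
    intro τ
    let ρ' : MvPolynomial (Fin n × Fin n) ℂ →ₐ[B] MvPolynomial (Fin n × Fin n) ℂ :=
      { (ρ τ).toRingHom with
        commutes' := fun b => by
          change ρ τ (algebraMap B (MvPolynomial (Fin n × Fin n) ℂ) b) = algebraMap B _ b
          rw [Subalgebra.algebraMap_def, Algebra.algebraMap_self, RingHom.id_apply]
          exact hρB τ b }
    have hρ' : ∀ x, ρ' x = ρ τ x := fun _ => rfl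
    have hc := AlgHom.congr_fun (MvPolynomial.comp_aeval (f := v) ρ') F
    rw [AlgHom.comp_apply, hρ'] at hc
    have hfg : (fun i => ρ' (v i)) = v ∘ ⇑τ := funext fun j => by rw [Function.comp_apply, hρ', hρv]
    rw [hc, aeval_rename, hfg]
  -- Step 3: averaging over `Sym_n`
  set N : ℕ := Fintype.card (Perm (Fin n)) with hNdef
  have hN : (N : ℂ) ≠ 0 := Nat.cast_ne_zero.2 Fintype.card_ne_zero
  have hsum : aeval v (∑ τ : Perm (Fin n), rename τ F) = (N : ℂ) • p := by
    rw [map_sum]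
    have : ∀ τ : Perm (Fin n), aeval v (rename τ F) = p := fun τ => by rw [← hρF, hF, hρp]
    simp only [this, Finset.sum_const, Finset.card_univ, hNdef]
    exact (Nat.cast_smul_eq_nsmul ℂ _ p).symm
  set G : MvPolynomial (Fin n) B := C (algebraMap ℂ B ((N : ℂ)⁻¹)) * ∑ τ : Perm (Fin n), rename τ F with hGdef
  have hG : aeval v G = p := by
    rw [hGdef, map_mul, aeval_C, hsum, ← IsScalarTower.algebraMap_apply, MvPolynomial.algebraMap_eq, smul_eq_C_mul,
      ← mul_assoc, ← map_mul, inv_mul_cancel₀ hN, C_1, one_mul]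
  have hGsym : ∀ τ' : Perm (Fin n), rename τ' G = G := by
    intro τ'
    rw [hGdef, map_mul, rename_C, map_sum]
    congr 1
    simp only [rename_rename]
    have hmul : ∀ τ : Perm (Fin n), ((τ' : Fin n → Fin n) ∘ (τ : Fin n → Fin n)) = ⇑(τ' * τ) := fun τ => rfl
    simp only [hmul]
    exact Fintype.sum_equiv (Equiv.mulLeft τ') _ _ (fun τ => rfl)
  -- Step 4: the fundamental theorem of symmetric polynomials over `B`
  have hGmem : G ∈ symmetricSubalgebra (Fin n) B := (mem_symmetricSubalgebra G).2 hGsym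
  obtain ⟨Q, hQ⟩ := esymmAlgHom_surjective B (σ := Fin n) (n := n) (by simp) ⟨G, hGmem⟩
  have hQ' : aeval (fun i : Fin n => esymm (Fin n) B ((i : ℕ) + 1)) Q = G := by
    have := congrArg Subtype.val hQ
    rwa [esymmAlgHom_apply] at this
  have hcomp := AlgHom.congr_fun (MvPolynomial.comp_aeval (f := fun i : Fin n => esymm (Fin n) B ((i : ℕ) + 1)) (aeval v)) Q
  rw [AlgHom.comp_apply, hQ', hG] at hcomp
  -- `hcomp : p = aeval (fun i => aeval v (esymm B (i+1))) Q`
  have hpB : p ∈ Algebra.adjoin B (Set.range fun i : Fin n => aeval v (esymm (Fin n) B ((i : ℕ) + 1))) := by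
    rw [Algebra.adjoin_range_eq_range_aeval, AlgHom.mem_range]
    exact ⟨Q, hcomp.symm⟩
  have hw : (fun i : Fin n => aeval v (esymm (Fin n) B ((i : ℕ) + 1))) =
      fun i : Fin n => aeval v (esymm (Fin n) ℂ ((i : ℕ) + 1)) := by
    funext i
    rw [← map_esymm (σ := Fin n) (R := ℂ) ((i : ℕ) + 1) (algebraMap ℂ B), aeval_map_algebraMap]
  rw [hw] at hpB
  rw [Algebra.adjoin_union_eq_adjoin_adjoin]
  exact (Subalgebra.mem_restrictScalars ℂ).2 hpB

/-! ### Matrix-symmetric elements of `ℂ[r, c]` -/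

/-- Column renaming `x_pq ↦ x_{p, τ q}` fixes the row sums. [folklore] -/
theorem colRename_rowSum (τ : Perm (Fin n)) (i : Fin n) :
    rename (fun q : Fin n × Fin n => (q.1, τ q.2)) (∑ j : Fin n, (X (i, j) : MvPolynomial (Fin n × Fin n) ℂ)) =
      ∑ j : Fin n, X (i, j) := by
  simp only [map_sum, rename_X]
  exact Equiv.sum_comp τ (fun j => (X (i, j) : MvPolynomial (Fin n × Fin n) ℂ))

/-- Column renaming permutes the column sums. [folklore] -/
theorem colRename_colSum (τ : Perm (Fin n)) (j : Fin n) :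
    rename (fun q : Fin n × Fin n => (q.1, τ q.2)) (∑ i : Fin n, (X (i, j) : MvPolynomial (Fin n × Fin n) ℂ)) =
      ∑ i : Fin n, X (i, τ j) := by
  simp only [map_sum, rename_X]

/-- Row renaming `x_pq ↦ x_{σ p, q}` permutes the row sums. [folklore] -/
theorem rowRename_rowSum (σ : Perm (Fin n)) (i : Fin n) :
    rename (fun q : Fin n × Fin n => (σ q.1, q.2)) (∑ j : Fin n, (X (i, j) : MvPolynomial (Fin n × Fin n) ℂ)) =
      ∑ j : Fin n, X (σ i, j) := by
  simp only [map_sum, rename_X]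

/-- Row renaming fixes the column sums. [folklore] -/
theorem rowRename_colSum (σ : Perm (Fin n)) (j : Fin n) :
    rename (fun q : Fin n × Fin n => (σ q.1, q.2)) (∑ i : Fin n, (X (i, j) : MvPolynomial (Fin n × Fin n) ℂ)) =
      ∑ i : Fin n, X (i, j) := by
  simp only [map_sum, rename_X]
  exact Equiv.sum_comp σ (fun i => (X (i, j) : MvPolynomial (Fin n × Fin n) ℂ))

/-- **A MATRIX-SYMMETRIC ELEMENT OF `ℂ[r, c]` IS A POLYNOMIAL IN `e_k(r)`, `e_k(c)`** (row sums `r_i = Σ_j x_ij`, column sums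
`c_j = Σ_i x_ij`, `1 ≤ k ≤ n`). [folklore] -/
theorem mem_adjoin_esymm_rowcol {p : MvPolynomial (Fin n × Fin n) ℂ}
    (hsym : ∀ σ τ : Perm (Fin n), rename (fun q : Fin n × Fin n => (σ q.1, τ q.2)) p = p)
    (hp : p ∈ Algebra.adjoin ℂ (Set.range (fun i : Fin n => ∑ j : Fin n, (X (i, j) : MvPolynomial (Fin n × Fin n) ℂ)) ∪
      Set.range (fun j : Fin n => ∑ i : Fin n, (X (i, j) : MvPolynomial (Fin n × Fin n) ℂ)))) :
    p ∈ Algebra.adjoin ℂ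
      ((Set.range fun k : Fin n =>
          aeval (fun i : Fin n => ∑ j : Fin n, (X (i, j) : MvPolynomial (Fin n × Fin n) ℂ)) (esymm (Fin n) ℂ ((k : ℕ) + 1))) ∪
        Set.range fun k : Fin n =>
          aeval (fun j : Fin n => ∑ i : Fin n, (X (i, j) : MvPolynomial (Fin n × Fin n) ℂ)) (esymm (Fin n) ℂ ((k : ℕ) + 1))) := by
  -- first symmetrise the columns over `ℂ[rows]`
  have h1 := mem_adjoin_esymm_of_symmetric
    (Set.range (fun i : Fin n => ∑ j : Fin n, (X (i, j) : MvPolynomial (Fin n × Fin n) ℂ)))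
    (fun j : Fin n => ∑ i : Fin n, (X (i, j) : MvPolynomial (Fin n × Fin n) ℂ))
    (fun τ => rename (fun q : Fin n × Fin n => (q.1, τ q.2)))
    (by rintro τ _ ⟨i, rfl⟩; exact colRename_rowSum τ i)
    (fun τ j => colRename_colSum τ j)
    (fun τ => by simpa only [Perm.coe_one, id_eq] using hsym 1 τ) hp
  -- then the rows over `ℂ[e(columns)]`
  rw [Set.union_comm] at h1
  have h2 := mem_adjoin_esymm_of_symmetric
    (Set.range fun k : Fin n =>
      aeval (fun j : Fin n => ∑ i : Fin n, (X (i, j) : MvPolynomial (Fin n × Fin n) ℂ)) (esymm (Fin n) ℂ ((k : ℕ) + 1)))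
    (fun i : Fin n => ∑ j : Fin n, (X (i, j) : MvPolynomial (Fin n × Fin n) ℂ))
    (fun σ => rename (fun q : Fin n × Fin n => (σ q.1, q.2)))
    (by
      rintro σ _ ⟨k, rfl⟩
      have hc := AlgHom.congr_fun (MvPolynomial.comp_aeval
        (f := fun j : Fin n => ∑ i : Fin n, (X (i, j) : MvPolynomial (Fin n × Fin n) ℂ))
        (rename (fun q : Fin n × Fin n => (σ q.1, q.2)))) (esymm (Fin n) ℂ ((k : ℕ) + 1))
      rw [AlgHom.comp_apply] at hc
      rw [hc]
      simp only [rowRename_colSum])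
    (fun σ i => rowRename_rowSum σ i)
    (fun σ => by simpa only [Perm.coe_one, id_eq] using hsym σ 1) h1
  rwa [Set.union_comm] at h2

/-! ### Newton, transported; restoration -/

/-- **Newton's identities, transported**: `e_k(v_0, …, v_{n-1}) ∈ ℂ[Σ_i v_i^m : m ∈ ℕ]` for every family `v` of polynomials and
`k ≤ n` (strong induction on `k` with Mathlib's `MvPolynomial.mul_esymm_eq_sum`, as in `NewtonProdPsum.esymm_mem_adjoin_psum`, then
evaluation at `v`). [folklore] -/
theorem aeval_esymm_mem_adjoin_powerSums (v : Fin n → MvPolynomial (Fin n × Fin n) ℂ) {k : ℕ} (hk : k ≤ n) :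
    aeval v (esymm (Fin n) ℂ k) ∈ Algebra.adjoin ℂ (Set.range fun m : ℕ => ∑ i : Fin n, v i ^ m) := by
  -- Newton in `ℂ[y_0, …, y_{n-1}]`
  have hN : ∀ k : ℕ, k ≤ n → esymm (Fin n) ℂ k ∈ Algebra.adjoin ℂ (Set.range fun m : ℕ => psum (Fin n) ℂ m) := by
    intro k
    induction k using Nat.strong_induction_on with
    | _ k ih =>
      intro hk
      rcases Nat.eq_zero_or_pos k with rfl | hpos
      · rw [esymm_zero]
        exact Subalgebra.one_mem _
      have hk0 : (k : ℂ) ≠ 0 := Nat.cast_ne_zero.mpr hpos.ne'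
      have key := MvPolynomial.mul_esymm_eq_sum (Fin n) ℂ k
      have hCk : esymm (Fin n) ℂ k = (k : ℂ)⁻¹ • ((k : MvPolynomial (Fin n) ℂ) * esymm (Fin n) ℂ k) := by
        rw [smul_eq_C_mul, ← mul_assoc, show (k : MvPolynomial (Fin n) ℂ) = C (k : ℂ) from (map_natCast C k).symm,
          ← map_mul, inv_mul_cancel₀ hk0, C_1, one_mul]
      have hneg : ∀ i : ℕ, (-1 : MvPolynomial (Fin n) ℂ) ^ i ∈
          Algebra.adjoin ℂ (Set.range fun m : ℕ => psum (Fin n) ℂ m) := fun i =>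
        Subalgebra.pow_mem _ (Subalgebra.neg_mem _ (Subalgebra.one_mem _)) _
      rw [hCk, key]
      refine Subalgebra.smul_mem _ (Subalgebra.mul_mem _ (hneg _) (Subalgebra.sum_mem _ fun a ha => ?_)) _
      rw [Finset.mem_filter, Finset.HasAntidiagonal.mem_antidiagonal] at ha
      obtain ⟨hab, halt⟩ := ha
      refine Subalgebra.mul_mem _ (Subalgebra.mul_mem _ (hneg _) (ih a.1 halt (by omega))) ?_
      exact Algebra.subset_adjoin ⟨a.2, rfl⟩
  -- evaluation at `v`
  have h2 : aeval v (esymm (Fin n) ℂ k) ∈ (Algebra.adjoin ℂ (Set.range fun m : ℕ => psum (Fin n) ℂ m)).map (aeval v) :=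
    Subalgebra.mem_map.2 ⟨_, hN k hk, rfl⟩
  rw [AlgHom.map_adjoin, ← Set.range_comp] at h2
  have hfun : ((aeval v : MvPolynomial (Fin n) ℂ →ₐ[ℂ] MvPolynomial (Fin n × Fin n) ℂ) ∘ fun m : ℕ => psum (Fin n) ℂ m) =
      fun m : ℕ => ∑ i : Fin n, v i ^ m := by
    funext m
    simp only [Function.comp_apply, psum, map_sum, map_pow, aeval_X]
  rwa [hfun] at h2

/-- **EVERY MATRIX-SYMMETRIC ELEMENT OF `ℂ[r, c]` IS `QPOrbitRestorable 9 n`.** [folklore] -/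
theorem qpOrbitRestorable_of_mem_adjoin_rowcol {p : MvPolynomial (Fin n × Fin n) ℂ}
    (hsym : ∀ σ τ : Perm (Fin n), rename (fun q : Fin n × Fin n => (σ q.1, τ q.2)) p = p)
    (hp : p ∈ Algebra.adjoin ℂ (Set.range (fun i : Fin n => ∑ j : Fin n, (X (i, j) : MvPolynomial (Fin n × Fin n) ℂ)) ∪
      Set.range (fun j : Fin n => ∑ i : Fin n, (X (i, j) : MvPolynomial (Fin n × Fin n) ℂ)))) :
    QPOrbitRestorable 9 n p := by
  refine RowColumnRestorable.qpOrbitRestorable_of_mem_adjoin_powerSums ?_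
  refine (Algebra.adjoin_le ?_ : Algebra.adjoin ℂ _ ≤ _) (mem_adjoin_esymm_rowcol hsym hp)
  rintro t (⟨k, rfl⟩ | ⟨k, rfl⟩)
  · have h := aeval_esymm_mem_adjoin_powerSums
      (fun i : Fin n => ∑ j : Fin n, (X (i, j) : MvPolynomial (Fin n × Fin n) ℂ)) (k := (k : ℕ) + 1) (by omega)
    refine (Algebra.adjoin_mono ?_) h
    rintro _ ⟨m, rfl⟩
    exact Or.inl ⟨m, rfl⟩
  · have h := aeval_esymm_mem_adjoin_powerSums
      (fun j : Fin n => ∑ i : Fin n, (X (i, j) : MvPolynomial (Fin n × Fin n) ℂ)) (k := (k : ℕ) + 1) (by omega)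
    refine (Algebra.adjoin_mono ?_) h
    rintro _ ⟨m, rfl⟩
    exact Or.inr ⟨m, rfl⟩

/-- **THE SUB-QUADRATIC DEPTH-THREE STRATUM OF A_∞ IS ORBIT-RESTORABLE.**  A matrix-symmetric polynomial on the `n × n` matrix
with a depth-three representation `p = Σ_{i<k} C(a i) · Π (L i)` (every factor of total degree `≤ 1`) of total product fan-in
`Σ_i |L i| < (n−1)²` has a square-symmetric circuit of orbit size `≤ 2^((log₂ n + 9)^9)`. [folklore] -/
theorem qpOrbitRestorable_of_depthThree_subquadratic {p : MvPolynomial (Fin n × Fin n) ℂ}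
    (hsym : ∀ σ τ : Perm (Fin n), rename (fun q : Fin n × Fin n => (σ q.1, τ q.2)) p = p)
    {k : ℕ} (a : Fin k → ℂ) (L : Fin k → Multiset (MvPolynomial (Fin n × Fin n) ℂ))
    (hL : ∀ i, ∀ ℓ ∈ L i, ℓ.totalDegree ≤ 1) (hp : p = ∑ i, C (a i) * (L i).prod)
    (hfan : ∑ i, Multiset.card (L i) < (n - 1) ^ 2) :
    QPOrbitRestorable 9 n p :=
  qpOrbitRestorable_of_mem_adjoin_rowcol hsym (RowColumnDichotomy.mem_adjoin_rowcol_of_depthThree hsym a L hL hp hfan)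

/-- **The stratum in the shape of the stub `stub_sigmaPiSigmaValue`**: a matrix-symmetric FAMILY given at every level by a
depth-three representation of total product fan-in `< (n−1)²` is quasi-polynomially orbit-restorable, with the absolute constant
`c = 9`. [folklore] -/
theorem restoration_of_subquadratic_family (f : (n : ℕ) → MvPolynomial (Fin n × Fin n) ℂ) (hsym : IsMatrixSymmetric f)
    (hrep : ∀ n : ℕ, ∃ (k : ℕ) (a : Fin k → ℂ) (L : Fin k → Multiset (MvPolynomial (Fin n × Fin n) ℂ)),
      (∀ i, ∀ ℓ ∈ L i, ℓ.totalDegree ≤ 1) ∧ f n = ∑ i, C (a i) * (L i).prod ∧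
        ∑ i, Multiset.card (L i) < (n - 1) ^ 2) :
    ∃ c : ℕ, ∀ n : ℕ, QPOrbitRestorable c n (f n) := by
  refine ⟨9, fun n => ?_⟩
  obtain ⟨k, a, L, hL, hf, hfan⟩ := hrep n
  exact qpOrbitRestorable_of_depthThree_subquadratic (hsym n) a L hL hf hfan

/-! ### The stratum by essential dimension -/

/-- **RESTORATION BY ESSENTIAL DIMENSION.**  A matrix-symmetric polynomial lying in `ℂ[Λ]` for some space `Λ` of affine forms
containing the constants with `dim Λ ≤ (n−1)²` — e.g. the span of `1` and the DISTINCT factors of any depth-three representation,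
however large its total fan-in — is `QPOrbitRestorable 9 n`. [folklore] -/
theorem qpOrbitRestorable_of_admissible {p : MvPolynomial (Fin n × Fin n) ℂ}
    (hsym : ∀ σ τ : Perm (Fin n), rename (fun q : Fin n × Fin n => (σ q.1, τ q.2)) p = p)
    {Λ : Submodule ℂ (MvPolynomial (Fin n × Fin n) ℂ)} [FiniteDimensional ℂ Λ]
    (hΛ : LinearSubalgebra.Admissible p Λ) (hdim : Module.finrank ℂ Λ ≤ (n - 1) ^ 2) :
    QPOrbitRestorable 9 n p :=
  qpOrbitRestorable_of_mem_adjoin_rowcol hsym (RowColumnDichotomy.mem_adjoin_rowcol_of_admissible hsym hΛ hdim)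

/-- **The stratum by number of DISTINCT factors**: a matrix-symmetric `p = Σ_{i<k} C(a i) · Π (L i)` (affine factors) whose set of
distinct factors has fewer than `(n−1)²` elements is `QPOrbitRestorable 9 n` (the total fan-in and the number of terms are
irrelevant). [folklore] -/
theorem qpOrbitRestorable_of_depthThree_distinct {p : MvPolynomial (Fin n × Fin n) ℂ}
    (hsym : ∀ σ τ : Perm (Fin n), rename (fun q : Fin n × Fin n => (σ q.1, τ q.2)) p = p)
    {k : ℕ} (a : Fin k → ℂ) (L : Fin k → Multiset (MvPolynomial (Fin n × Fin n) ℂ))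
    (hL : ∀ i, ∀ ℓ ∈ L i, ℓ.totalDegree ≤ 1) (hp : p = ∑ i, C (a i) * (L i).prod)
    (hdist : (Finset.univ.biUnion fun i => (L i).toFinset).card < (n - 1) ^ 2) :
    QPOrbitRestorable 9 n p := by
  set S : Finset (MvPolynomial (Fin n × Fin n) ℂ) := insert (C 1) (Finset.univ.biUnion fun i => (L i).toFinset) with hS
  set Λ : Submodule ℂ (MvPolynomial (Fin n × Fin n) ℂ) := Submodule.span ℂ (S : Set (MvPolynomial (Fin n × Fin n) ℂ))
    with hΛ
  haveI : FiniteDimensional ℂ Λ := FiniteDimensional.span_finset ℂ S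
  have hcard : S.card ≤ (n - 1) ^ 2 := by
    refine (Finset.card_insert_le _ _).trans ?_
    omega
  have hdim : Module.finrank ℂ Λ ≤ (n - 1) ^ 2 := (finrank_span_finset_le_card S).trans hcard
  have hadm : LinearSubalgebra.Admissible p Λ := by
    refine ⟨?_, Submodule.subset_span (by simp [hS]), ?_⟩
    · rw [hΛ, Submodule.span_le]
      intro x hx
      rw [hS, Finset.coe_insert, Set.mem_insert_iff] at hx
      rcases hx with rfl | hx
      · exact LinearSubalgebra.mem_deg1.2 (by rw [totalDegree_C]; exact Nat.zero_le _)
      · rw [Finset.mem_coe, Finset.mem_biUnion] at hx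
        obtain ⟨i, -, hi⟩ := hx
        exact LinearSubalgebra.mem_deg1.2 (hL i x (Multiset.mem_toFinset.1 hi))
    · rw [hp]
      refine Subalgebra.sum_mem _ fun i _ => Subalgebra.mul_mem _ (Subalgebra.algebraMap_mem _ _) ?_
      refine Subalgebra.multiset_prod_mem _ fun ℓ hℓ => Algebra.subset_adjoin ?_
      refine Submodule.subset_span ?_
      rw [hS, Finset.coe_insert]
      refine Set.mem_insert_of_mem _ ?_
      rw [Finset.mem_coe, Finset.mem_biUnion]
      exact ⟨i, Finset.mem_univ _, Multiset.mem_toFinset.2 hℓ⟩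
  exact qpOrbitRestorable_of_admissible hsym hadm hdim

end RowColumnStratum

end Summit.ValiantsHypothesis.ValiantsHypothesis.Theorems

end
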